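import Mathlib
import Summits.Ventures.HodgeRepro.Tier4.Common.AdelicDefs
import Summits.Ventures.HodgeRepro.Tier4.Common.AdelicPlaces
import Summits.Ventures.HodgeRepro.Tier4.Line1.ModulusEmbed

/-!
# Tier4/Line1/AdelicSingle — adeles supported at one place, and «`M` at one place, the identity elsewhere»

Blind re-derivation cell `pub-hodge-repro`, Tier 4 (README §9–§10), seat t4-L2-p2 (gen 2), wall-breaker on the
cocompactness rung C5 of LINE L1 («the adelic modulus», t4-L1-p5's `I1c-rungs-sig.lean`).  Target tree path
`lean/Summits/Ventures/HodgeRepro/Tier4/Line1/AdelicSingle.lean`.  Imports typer-2's `Common/AdelicPlaces`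
(`adComponentFin v : 𝔸_k →+* k_v`, `adComponentInf w : 𝔸_k →+* k_w`) and `Line1/ModulusEmbed` (`embMat`).

For each place `v` of `k` the map «`c` at `v`, `0` elsewhere» is a NON-UNITAL ring homomorphism `k_v →ₙ+* 𝔸_k`
(`singleInf w`, `singleFin v`: `Pi.single` on the archimedean factor, `RestrictedProduct.single` on the finite
adeles); evaluating it at the same place gives back `c`, at any other place (of either kind) gives `0`.  Hence for an
invertible `M : Matrix ι ι 𝔸_k` with component `M_v := M.map (adComponent v)`, the matrix `embMat (single v) M_v`
(«`M_v` at `v`, the identity elsewhere») has component `M_v` at `v` and `1` at every other place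
(`mapMatrix_embMat_self`, `mapMatrix_embMat_zero`).  This is all the «place decomposition» the modulus formula needs.

Nothing here asserts anything about the Hodge conjecture for CM abelian varieties, which is NOT proved (HC_CM is NOT
proved by anyone in this repository).
-/

set_option autoImplicit false

noncomputable section

namespace Summit.Ventures.HodgeRepro.Tier4.Line1

open NumberField IsDedekindDomain HeightOneSpectrum Matrix Common
open scoped NumberField RestrictedProduct

section Single

variable (k : Type) [Field k] [NumberField k]

open Classical in
/-- **An adele supported at an infinite place** `w`: `c ↦ (Pi.single w c, 0)` — a non-unital ring homomorphism
`k_w →ₙ+* 𝔸_k`. -/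
def singleInf (w : InfinitePlace k) : w.Completion →ₙ+* Ad k where
  toFun c := (Pi.single w c, 0)
  map_zero' := Prod.ext (by rw [Pi.single_zero]; rfl) rfl
  map_add' a b := Prod.ext
    (show Pi.single w (a + b) = Pi.single w a + Pi.single w b from Pi.single_add w a b)
    (show (0 : FiniteAdeleRing (𝓞 k) k) = 0 + 0 from (add_zero 0).symm)
  map_mul' a b := Prod.ext
    (show Pi.single w (a * b) = Pi.single w a * Pi.single w b from Pi.single_mul w a b)
    (show (0 : FiniteAdeleRing (𝓞 k) k) = 0 * 0 from (mul_zero 0).symm)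

open Classical in
/-- **An adele supported at a finite place** `v`: `c ↦ (0, single v c)` — a non-unital ring homomorphism
`k_v →ₙ+* 𝔸_k`. -/
def singleFin (v : HeightOneSpectrum (𝓞 k)) : v.adicCompletion k →ₙ+* Ad k where
  toFun c := (0, RestrictedProduct.single (fun w : HeightOneSpectrum (𝓞 k) => w.adicCompletionIntegers k) v c)
  map_zero' := Prod.ext rfl (by rw [RestrictedProduct.single_zero]; rfl)
  map_add' a b := Prod.ext
    (show (0 : InfiniteAdeleRing k) = 0 + 0 from (add_zero 0).symm)
    (show RestrictedProduct.single (fun w : HeightOneSpectrum (𝓞 k) => w.adicCompletionIntegers k) v (a + b) =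
      RestrictedProduct.single _ v a + RestrictedProduct.single _ v b from RestrictedProduct.single_add _ v a b)
  map_mul' a b := Prod.ext
    (show (0 : InfiniteAdeleRing k) = 0 * 0 from (mul_zero 0).symm)
    (show RestrictedProduct.single (fun w : HeightOneSpectrum (𝓞 k) => w.adicCompletionIntegers k) v (a * b) =
      RestrictedProduct.single _ v a * RestrictedProduct.single _ v b by
        apply RestrictedProduct.ext
        intro j
        change Pi.single v (a * b) j = Pi.single v a j * Pi.single v b j
        rcases eq_or_ne j v with rfl | h
        · simp [Pi.single_eq_same]
        · simp [Pi.single_eq_of_ne h])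

open Classical in
/-- The value of `singleInf`. -/
theorem singleInf_apply (w : InfinitePlace k) (c : w.Completion) : singleInf k w c = (Pi.single w c, 0) := rfl

open Classical in
/-- The value of `singleFin`. -/
theorem singleFin_apply (v : HeightOneSpectrum (𝓞 k)) (c : v.adicCompletion k) :
    singleFin k v c = (0, RestrictedProduct.single (fun w : HeightOneSpectrum (𝓞 k) => w.adicCompletionIntegers k) v c) :=
  rfl

/-- Evaluating `singleInf w c` at `w` gives `c`. -/
theorem adComponentInf_singleInf_same (w : InfinitePlace k) (c : w.Completion) :
    adComponentInf k w (singleInf k w c) = c := by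
  classical
  show (Pi.single w c : (w' : InfinitePlace k) → w'.Completion) w = c
  exact Pi.single_eq_same w c

/-- Evaluating `singleInf w c` at another infinite place gives `0`. -/
theorem adComponentInf_singleInf_of_ne {w w' : InfinitePlace k} (h : w' ≠ w) (c : w.Completion) :
    adComponentInf k w' (singleInf k w c) = 0 := by
  classical
  show (Pi.single w c : (w' : InfinitePlace k) → w'.Completion) w' = 0
  exact Pi.single_eq_of_ne h c

/-- Evaluating `singleInf w c` at a finite place gives `0`. -/
theorem adComponentFin_singleInf (w : InfinitePlace k) (v : HeightOneSpectrum (𝓞 k)) (c : w.Completion) :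
    adComponentFin k v (singleInf k w c) = 0 := rfl

/-- Evaluating `singleFin v c` at `v` gives `c`. -/
theorem adComponentFin_singleFin_same (v : HeightOneSpectrum (𝓞 k)) (c : v.adicCompletion k) :
    adComponentFin k v (singleFin k v c) = c := by
  classical
  show (RestrictedProduct.single (fun w : HeightOneSpectrum (𝓞 k) => w.adicCompletionIntegers k) v c) v = c
  exact RestrictedProduct.single_eq_same _ v c

/-- Evaluating `singleFin v c` at another finite place gives `0`. -/
theorem adComponentFin_singleFin_of_ne {v v' : HeightOneSpectrum (𝓞 k)} (h : v' ≠ v) (c : v.adicCompletion k) :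
    adComponentFin k v' (singleFin k v c) = 0 := by
  classical
  show (RestrictedProduct.single (fun w : HeightOneSpectrum (𝓞 k) => w.adicCompletionIntegers k) v c) v' = 0
  exact RestrictedProduct.single_eq_of_ne _ c h

/-- Evaluating `singleFin v c` at an infinite place gives `0`. -/
theorem adComponentInf_singleFin (v : HeightOneSpectrum (𝓞 k)) (w : InfinitePlace k) (c : v.adicCompletion k) :
    adComponentInf k w (singleFin k v c) = 0 := rfl

end Single

section EmbMatComponents

variable {ι : Type*} [Fintype ι] [DecidableEq ι]
variable {R : Type*} [CommRing R] {F : Type*} [Field F]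

omit [Fintype ι] in
/-- The component at the place of `s` of `embMat s N` is `N` (when `ev ∘ s = id`). -/
theorem mapMatrix_embMat_self (ev : R →+* F) (s : F →ₙ+* R) (hs : ∀ c, ev (s c) = c) (N : Matrix ι ι F) :
    (embMat s N).map ev = N := by
  unfold embMat
  rw [Matrix.map_add ev (map_add ev), Matrix.map_one ev (map_zero ev) (map_one ev), Matrix.map_map]
  have : (⇑ev ∘ ⇑s) = id := funext hs
  rw [this, Matrix.map_id, add_sub_cancel]

omit [Fintype ι] in
/-- The component at any other place of `embMat s N` is `1` (when `ev' ∘ s = 0`). -/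
theorem mapMatrix_embMat_zero {F' : Type*} [Field F'] (ev' : R →+* F') (s : F →ₙ+* R) (hs : ∀ c, ev' (s c) = 0)
    (N : Matrix ι ι F) : (embMat s N).map ev' = 1 := by
  unfold embMat
  rw [Matrix.map_add ev' (map_add ev'), Matrix.map_one ev' (map_zero ev') (map_one ev'), Matrix.map_map]
  have : (⇑ev' ∘ ⇑s) = fun _ => (0 : F') := funext hs
  rw [this]
  have h0 : (N - 1).map (fun _ => (0 : F')) = 0 := by
    ext i j
    simp
  rw [h0, add_zero]

/-- The component map on units: `Units.map ev.mapMatrix`. -/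
def evUnits (ev : R →+* F) : (Matrix ι ι R)ˣ →* (Matrix ι ι F)ˣ := Units.map (ev.mapMatrix).toMonoidHom

/-- The value of `evUnits`. -/
@[simp]
theorem coe_evUnits (ev : R →+* F) (M : (Matrix ι ι R)ˣ) :
    ((evUnits ev M : (Matrix ι ι F)ˣ) : Matrix ι ι F) = (M : Matrix ι ι R).map ev := rfl

/-- `evUnits ev (Units.map (embMatHom s) N) = N` when `ev ∘ s = id`. -/
theorem evUnits_map_embMatHom_self (ev : R →+* F) (s : F →ₙ+* R) (hs : ∀ c, ev (s c) = c)
    (N : (Matrix ι ι F)ˣ) : evUnits ev (Units.map (embMatHom s) N) = N := by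
  apply Units.ext
  simp only [coe_evUnits, Units.coe_map, embMatHom_apply]
  exact mapMatrix_embMat_self ev s hs (N : Matrix ι ι F)

/-- `evUnits ev' (Units.map (embMatHom s) N) = 1` when `ev' ∘ s = 0`. -/
theorem evUnits_map_embMatHom_zero {F' : Type*} [Field F'] (ev' : R →+* F') (s : F →ₙ+* R)
    (hs : ∀ c, ev' (s c) = 0) (N : (Matrix ι ι F)ˣ) : evUnits ev' (Units.map (embMatHom s) N) = 1 := by
  apply Units.ext
  simp only [coe_evUnits, Units.coe_map, embMatHom_apply, Units.val_one]
  exact mapMatrix_embMat_zero ev' s hs (N : Matrix ι ι F)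

/-- **The strip at one place**: `M = E * M'` with `E := Units.map (embMatHom s) (evUnits ev M)` («`M_v` at `v`, the
identity elsewhere») and `M' := E⁻¹ * M`, whose component at the place of `s` is `1`. -/
theorem evUnits_inv_mul_self (ev : R →+* F) (s : F →ₙ+* R) (hs : ∀ c, ev (s c) = c) (M : (Matrix ι ι R)ˣ) :
    evUnits ev ((Units.map (embMatHom s) (evUnits ev M))⁻¹ * M) = 1 := by
  rw [map_mul, map_inv, evUnits_map_embMatHom_self ev s hs, inv_mul_cancel]

/-- The components at the other places of `M' := E⁻¹ * M` are those of `M`. -/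
theorem evUnits_inv_mul_of_ne {F' : Type*} [Field F'] (ev : R →+* F) (ev' : R →+* F') (s : F →ₙ+* R)
    (hs : ∀ c, ev' (s c) = 0) (M : (Matrix ι ι R)ˣ) :
    evUnits ev' ((Units.map (embMatHom s) (evUnits ev M))⁻¹ * M) = evUnits ev' M := by
  rw [map_mul, map_inv, evUnits_map_embMatHom_zero ev' s hs, inv_one, one_mul]

end EmbMatComponents

end Summit.Ventures.HodgeRepro.Tier4.Line1

end
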